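import Summits.KontsevichZagierPeriods.KontsevichZagierPeriods.Theorems.GpcLegendreLemniscatic.Negative.LoadBearing
import Summits.KontsevichZagierPeriods.KontsevichZagierPeriods.Theorems.MzvKernelInKZTwoPosetsInteriorLandenAux1
import Mathlib.MeasureTheory.Function.Jacobian

/-!
# `GpcLegendreLemniscatic` (stmt-KontsevichZagierPeriods-0280), line `hyperbola-fibration-conic`: stub `stub_fibration`

Move M1 of the line: the **hyperbola fibration**. On the open unit square `(0,1)²` (coordinates
`z 0, z 1`) the one-coordinate substitution `Φ₁ z = update z 1 (z 0 * z 1)` (`t = x₀x₁`, keeping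
`y = x₀ = z 0`) is a bijection onto the triangle `T = {0 < z1 < z0 < 1}` with Jacobian determinant
`z 0` (tree tool `stub_interiorLandenAux1`: the Jacobian of a one-coordinate substitution is the
ordinary derivative along that coordinate). Since `√(z0⁴ − (z0 z1)⁴) = z0² √(1 − z1⁴)`, the
pull-back identity `2z0²/(√(1−z0⁴)√(1−z1⁴)) = h(Φ₁ z) · |z0|` holds with
`h z = 2z0³/(√(1−z0⁴)√(z0⁴−z1⁴))`, so Kontsevich–Zagier's rule (2) (change of variables, with
exactly the hypotheses of `KZ.changeOfVariablesRel`) gives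
`[(0,1)², 2z0²/(√(1−z0⁴)√(1−z1⁴))] ~ [T, h]`; integrability of `h` on `T` is transported along
`Φ₁` by `MeasureTheory.integrableOn_image_iff_integrableOn_abs_det_fderiv_smul`.

No definitions and no notation are introduced (all objects are written out). Reference: M. Kontsevich, D. Zagier,
*Periods* (2001), §1.2 rule (2).
-/

noncomputable section

open MeasureTheory Set
open Literature.NumberTheory.Transcendental
open Literature.NumberTheory.Transcendental.KZ
open Literature.ModelTheory.ExponentialFields (IsSemialgebraic)
open Summit.KontsevichZagierPeriods.Grothendieck.GpcLegendreLemniscaticNegative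
open Summit.KontsevichZagierPeriods.MzvKernelInKZ.TwoPosets.Landen

namespace Summit.KontsevichZagierPeriods.Grothendieck.GpcLegendreLemniscaticLine

/-! ## Elementary facts -/

/-- `0 ≠ 1` in `Fin 2`. [folklore] -/
theorem fib_zero_ne_one : (0 : Fin 2) ≠ 1 := by decide

/-- On the triangle: `0 < 1 − z0⁴`. [folklore] -/
theorem fib_tri_one_sub_pow_pos {z : Fin 2 → ℝ} (hz : z ∈ {z : Fin 2 → ℝ | 0 < z 1 ∧ z 1 < z 0 ∧ z 0 < 1}) : 0 < 1 - z 0 ^ 4 :=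
  sub_pos.mpr (pow_lt_one₀ (hz.1.trans hz.2.1).le hz.2.2 four_ne_zero)

/-- On the triangle: `0 < z0⁴ − z1⁴`. [folklore] -/
theorem fib_tri_pow_sub_pow_pos {z : Fin 2 → ℝ} (hz : z ∈ {z : Fin 2 → ℝ | 0 < z 1 ∧ z 1 < z 0 ∧ z 0 < 1}) : 0 < z 0 ^ 4 - z 1 ^ 4 :=
  sub_pos.mpr (pow_lt_pow_left₀ hz.2.1 hz.1.le four_ne_zero)

/-! ## The map `(fun z : Fin 2 → ℝ => Function.update z 1 (z 0 * z 1))`: image, injectivity, semialgebraicity, derivative -/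

/-- `(fun z : Fin 2 → ℝ => Function.update z 1 (z 0 * z 1))` maps the square into the triangle. [folklore] -/
theorem fib_mem_tri {z : Fin 2 → ℝ} (hz : z ∈ unitSq) : (fun z : Fin 2 → ℝ => Function.update z 1 (z 0 * z 1)) z ∈ {z : Fin 2 → ℝ | 0 < z 1 ∧ z 1 < z 0 ∧ z 0 < 1} := by
  have h0 := hz 0
  have h1 := hz 1
  refine ⟨?_, ?_, ?_⟩
  · show 0 < Function.update z 1 (z 0 * z 1) 1
    rw [Function.update_self]
    exact mul_pos h0.1 h1.1
  · show Function.update z 1 (z 0 * z 1) 1 < Function.update z 1 (z 0 * z 1) 0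
    rw [Function.update_self, Function.update_of_ne fib_zero_ne_one]
    exact mul_lt_of_lt_one_right h0.1 h1.2
  · show Function.update z 1 (z 0 * z 1) 0 < 1
    rw [Function.update_of_ne fib_zero_ne_one]
    exact h0.2

/-- `(fun z : Fin 2 → ℝ => Function.update z 1 (z 0 * z 1))` maps the square onto the triangle (inverse `v ↦ update v 1 (v 1 / v 0)`). [folklore] -/
theorem fib_image : (fun z : Fin 2 → ℝ => Function.update z 1 (z 0 * z 1)) '' unitSq = {z : Fin 2 → ℝ | 0 < z 1 ∧ z 1 < z 0 ∧ z 0 < 1} := by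
  refine Subset.antisymm ?_ ?_
  · rintro _ ⟨z, hz, rfl⟩
    exact fib_mem_tri hz
  · rintro v ⟨h1, h10, h0⟩
    have hv0 : 0 < v 0 := h1.trans h10
    refine ⟨Function.update v 1 (v 1 / v 0), ?_, ?_⟩
    · refine Fin.forall_fin_two.mpr ⟨?_, ?_⟩
      · rw [Function.update_of_ne fib_zero_ne_one]
        exact ⟨hv0, h0⟩
      · rw [Function.update_self]
        exact ⟨div_pos h1 hv0, (div_lt_one hv0).mpr h10⟩
    · funext i
      fin_cases i
      · simp
      · simp only [Function.update_self, Function.update_of_ne fib_zero_ne_one]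
        show v 0 * (v 1 / v 0) = v 1
        field_simp

/-- `(fun z : Fin 2 → ℝ => Function.update z 1 (z 0 * z 1))` is injective on the square (coordinate `0` is kept, then cancel `z 0 > 0`). [folklore] -/
theorem fib_injOn : InjOn (fun z : Fin 2 → ℝ => Function.update z 1 (z 0 * z 1)) unitSq := by
  intro x hx z hz h
  have h0 : x 0 = z 0 := by
    simpa only [Function.update_of_ne fib_zero_ne_one] using congrFun h 0
  funext i
  fin_cases i
  · exact h0
  · have := congrFun h 1
    simp only [Function.update_self] at this
    rw [h0] at this
    exact mul_left_cancel₀ (hz 0).1.ne' this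

/-- `(fun z : Fin 2 → ℝ => Function.update z 1 (z 0 * z 1))` is a `ℚ`-polynomial map, hence `ℚ`-semialgebraic on the square. [folklore] -/
theorem fib_isSemialgebraicMapOn : IsSemialgebraicMapOn ℚ unitSq (fun z : Fin 2 → ℝ => Function.update z 1 (z 0 * z 1)) := by
  refine (isSemialgebraicMapOn_aeval isSemialgebraic_unitSq fun j =>
    if j = 1 then MvPolynomial.X 0 * MvPolynomial.X 1 else MvPolynomial.X j).congr fun x _ => ?_
  funext j
  fin_cases j
  · simp
  · simp

/-- `(fun z : Fin 2 → ℝ => Function.update z 1 (z 0 * z 1))` is differentiable everywhere with Jacobian determinant `z 0`: a derivative field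
(one-coordinate substitution, `stub_interiorLandenAux1`). [folklore] -/
theorem fib_hasFDerivAt : ∃ D : (Fin 2 → ℝ) → ((Fin 2 → ℝ) →L[ℝ] (Fin 2 → ℝ)),
    ∀ z : Fin 2 → ℝ, HasFDerivAt (fun z : Fin 2 → ℝ => Function.update z 1 (z 0 * z 1)) (D z) z ∧ (D z).det = z 0 := by
  have h : ∀ z : Fin 2 → ℝ, ∃ L : (Fin 2 → ℝ) →L[ℝ] (Fin 2 → ℝ),
      HasFDerivAt (fun z : Fin 2 → ℝ => Function.update z 1 (z 0 * z 1)) L z ∧ L.det = z 0 := by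
    intro z
    have hg : DifferentiableAt ℝ (fun y : Fin 2 → ℝ => y 0 * y 1) z :=
      (differentiableAt_apply 0 z).mul (differentiableAt_apply 1 z)
    have hd : HasDerivAt (fun t => (Function.update z 1 t) 0 * (Function.update z 1 t) 1)
        (z 0) (z 1) := by
      simp only [Function.update_self, Function.update_of_ne fib_zero_ne_one]
      simpa using (hasDerivAt_id (z 1)).const_mul (z 0)
    exact stub_interiorLandenAux1 1 (fun y => y 0 * y 1) z (z 0) hg hd
  choose D hD using h
  exact ⟨D, hD⟩

/-! ## The pull-back identity -/

/-- On the square: `2z0²/(√(1−z0⁴)√(1−z1⁴)) = h((fun z : Fin 2 → ℝ => Function.update z 1 (z 0 * z 1)) z) · |z0|`, because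
`√(z0⁴ − (z0 z1)⁴) = z0² √(1 − z1⁴)`. [folklore] -/
theorem fib_pullback {z : Fin 2 → ℝ} (hz : z ∈ unitSq) :
    2 * z 0 ^ 2 / (Real.sqrt (1 - z 0 ^ 4) * Real.sqrt (1 - z 1 ^ 4)) = (fun z : Fin 2 → ℝ => 2 * z 0 ^ 3 / (Real.sqrt (1 - z 0 ^ 4) * Real.sqrt (z 0 ^ 4 - z 1 ^ 4))) ((fun z : Fin 2 → ℝ => Function.update z 1 (z 0 * z 1)) z) * |z 0| := by
  have h0 := hz 0
  have h1 := hz 1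
  have hz0 : 0 < z 0 := h0.1
  have hA : 0 < 1 - z 0 ^ 4 := sub_pos.mpr (pow_lt_one₀ h0.1.le h0.2 four_ne_zero)
  have hB : 0 < 1 - z 1 ^ 4 := sub_pos.mpr (pow_lt_one₀ h1.1.le h1.2 four_ne_zero)
  simp only [Function.update_self, Function.update_of_ne fib_zero_ne_one]
  rw [abs_of_pos hz0]
  have hsq : Real.sqrt (z 0 ^ 4 - (z 0 * z 1) ^ 4) = z 0 ^ 2 * Real.sqrt (1 - z 1 ^ 4) := by
    rw [show z 0 ^ 4 - (z 0 * z 1) ^ 4 = (z 0 ^ 2) ^ 2 * (1 - z 1 ^ 4) by ring,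
      Real.sqrt_mul (by positivity), Real.sqrt_sq (by positivity)]
  rw [hsq]
  have ha : Real.sqrt (1 - z 0 ^ 4) ≠ 0 := (Real.sqrt_pos.mpr hA).ne'
  have hb : Real.sqrt (1 - z 1 ^ 4) ≠ 0 := (Real.sqrt_pos.mpr hB).ne'
  field_simp

/-! ## The triangle representation: semialgebraicity -/

/-- The triangle is `ℚ`-semialgebraic (three strict polynomial inequalities). [folklore] -/
theorem fib_isSemialgebraic_tri : IsSemialgebraic ℚ {z : Fin 2 → ℝ | 0 < z 1 ∧ z 1 < z 0 ∧ z 0 < 1} := by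
  have h1 : IsSemialgebraic ℚ {z : Fin 2 → ℝ | 0 < z 1} := by
    simpa using Literature.ModelTheory.ExponentialFields.isSemialgebraic_setOf_eval_pos (k := ℚ)
      (R := ℝ) (MvPolynomial.X 1 : MvPolynomial (Fin 2) ℚ)
  have h2 : IsSemialgebraic ℚ {z : Fin 2 → ℝ | z 1 < z 0} := by
    simpa using Literature.ModelTheory.ExponentialFields.isSemialgebraic_setOf_eval_lt (k := ℚ)
      (R := ℝ) (MvPolynomial.X 1 : MvPolynomial (Fin 2) ℚ) (MvPolynomial.X 0)
  have h3 : IsSemialgebraic ℚ {z : Fin 2 → ℝ | z 0 < 1} := by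
    simpa using Literature.ModelTheory.ExponentialFields.isSemialgebraic_setOf_eval_lt (k := ℚ)
      (R := ℝ) (MvPolynomial.X 0 : MvPolynomial (Fin 2) ℚ) 1
  exact h1.inter (h2.inter h3)

/-- The triangle integrand `h` is `ℚ`-semialgebraic on the triangle (a polynomial divided by a
product of square roots of polynomials, the denominator non-vanishing). [folklore] -/
theorem fib_isSemialgebraicFunOn : IsSemialgebraicFunOn ℚ {z : Fin 2 → ℝ | 0 < z 1 ∧ z 1 < z 0 ∧ z 0 < 1} (fun z : Fin 2 → ℝ => 2 * z 0 ^ 3 / (Real.sqrt (1 - z 0 ^ 4) * Real.sqrt (z 0 ^ 4 - z 1 ^ 4))) := by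
  have hs := fib_isSemialgebraic_tri
  have hnum : IsSemialgebraicFunOn ℚ {z : Fin 2 → ℝ | 0 < z 1 ∧ z 1 < z 0 ∧ z 0 < 1} (fun z => 2 * z 0 ^ 3) := by
    refine (isSemialgebraicFunOn_aeval hs (2 * MvPolynomial.X 0 ^ 3 : MvPolynomial (Fin 2) ℚ)).congr
      fun z _ => ?_
    simp
  have hA : IsSemialgebraicFunOn ℚ {z : Fin 2 → ℝ | 0 < z 1 ∧ z 1 < z 0 ∧ z 0 < 1} (fun z => 1 - z 0 ^ 4) := by
    refine (isSemialgebraicFunOn_aeval hs (1 - MvPolynomial.X 0 ^ 4 : MvPolynomial (Fin 2) ℚ)).congr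
      fun z _ => ?_
    simp
  have hB : IsSemialgebraicFunOn ℚ {z : Fin 2 → ℝ | 0 < z 1 ∧ z 1 < z 0 ∧ z 0 < 1} (fun z => z 0 ^ 4 - z 1 ^ 4) := by
    refine (isSemialgebraicFunOn_aeval hs
      (MvPolynomial.X 0 ^ 4 - MvPolynomial.X 1 ^ 4 : MvPolynomial (Fin 2) ℚ)).congr fun z _ => ?_
    simp
  have hden := IsSemialgebraicFunOn.mul_holds (IsSemialgebraicFunOn.sqrt_holds hA)
    (IsSemialgebraicFunOn.sqrt_holds hB)
  refine ((hnum.div hden) fun z hz => ?_).congr fun z _ => ?_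
  · exact mul_ne_zero (Real.sqrt_pos.mpr (fib_tri_one_sub_pow_pos hz)).ne'
      (Real.sqrt_pos.mpr (fib_tri_pow_sub_pow_pos hz)).ne'
  · rfl

/-! ## The registered stub -/

/-- **Stub `stub_fibration`** of line `hyperbola-fibration-conic` (crux
stmt-KontsevichZagierPeriods-0280, `GpcLegendreLemniscatic`), move M1: the one-coordinate
substitution `z ↦ update z 1 (z 0 * z 1)` is ONE rule-(2) move from
`[(0,1)², 2z0²/(√(1−z0⁴)√(1−z1⁴))]` to the triangle representation
`[{0 < z1 < z0 < 1}, 2z0³/(√(1−z0⁴)√(z0⁴−z1⁴))]` (Jacobian `z0`); the integrability of the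
triangle integrand is transported along the substitution.
[cite: KontsevichZagier2001, §1.2 rule (2)] -/
theorem stub_fibration :
    ∀ q : IntegralRep 2, q.domain = unitSq →
      EqOn q.integrand (fun x => 2 * x 0 ^ 2 / (Real.sqrt (1 - x 0 ^ 4) * Real.sqrt (1 - x 1 ^ 4))) unitSq →
      ∃ T : IntegralRep 2, T.domain = {z : Fin 2 → ℝ | 0 < z 1 ∧ z 1 < z 0 ∧ z 0 < 1} ∧
        EqOn T.integrand (fun z => 2 * z 0 ^ 3 / (Real.sqrt (1 - z 0 ^ 4) * Real.sqrt (z 0 ^ 4 - z 1 ^ 4)))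
          {z : Fin 2 → ℝ | 0 < z 1 ∧ z 1 < z 0 ∧ z 0 < 1} ∧
        Equivalent q T := by
  intro q hqd hqi
  obtain ⟨D, hD⟩ := fib_hasFDerivAt
  have hmeas : MeasurableSet unitSq :=
    Literature.ModelTheory.ExponentialFields.IsSemialgebraic.measurableSet_holds isSemialgebraic_unitSq
  have hpull : ∀ z ∈ unitSq, q.integrand z = (fun z : Fin 2 → ℝ => 2 * z 0 ^ 3 / (Real.sqrt (1 - z 0 ^ 4) * Real.sqrt (z 0 ^ 4 - z 1 ^ 4))) ((fun z : Fin 2 → ℝ => Function.update z 1 (z 0 * z 1)) z) * |(D z).det| := fun z hz => by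
    rw [hqi hz, (hD z).2]
    exact fib_pullback hz
  have hint : IntegrableOn (fun z : Fin 2 → ℝ => 2 * z 0 ^ 3 / (Real.sqrt (1 - z 0 ^ 4) * Real.sqrt (z 0 ^ 4 - z 1 ^ 4))) {z : Fin 2 → ℝ | 0 < z 1 ∧ z 1 < z 0 ∧ z 0 < 1} volume := by
    rw [← fib_image]
    refine (integrableOn_image_iff_integrableOn_abs_det_fderiv_smul volume hmeas
      (fun z _ => (hD z).1.hasFDerivWithinAt) fib_injOn _).mpr ?_
    have h1 : IntegrableOn q.integrand unitSq volume := hqd ▸ q.integrableOn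
    refine h1.congr_fun (fun z hz => ?_) hmeas
    rw [hpull z hz, smul_eq_mul, mul_comm]
  refine ⟨⟨{z : Fin 2 → ℝ | 0 < z 1 ∧ z 1 < z 0 ∧ z 0 < 1}, (fun z : Fin 2 → ℝ => 2 * z 0 ^ 3 / (Real.sqrt (1 - z 0 ^ 4) * Real.sqrt (z 0 ^ 4 - z 1 ^ 4))), fib_isSemialgebraic_tri, fib_isSemialgebraicFunOn, hint⟩, rfl, fun _ _ => rfl, ?_⟩
  refine changeOfVariablesRel_subset_relations ⟨2, q, _, (fun z : Fin 2 → ℝ => Function.update z 1 (z 0 * z 1)), D, ?_,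
    fun z _ => (hD z).1.hasFDerivWithinAt, ?_, ?_, fun z hz => ?_, rfl⟩
  · rw [hqd]; exact fib_isSemialgebraicMapOn
  · rw [hqd]; exact fib_injOn
  · rw [hqd]; exact fib_image.symm
  · rw [hqd] at hz
    exact hpull z hz

end Summit.KontsevichZagierPeriods.Grothendieck.GpcLegendreLemniscaticLine
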